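import Summits.Langlands.Langlands.Theorems.DyadicOddResidueDyadicEisensteinFMStubInducedCase
import Literature.NumberTheory.GaloisRepresentations.PatchingLemma
import Literature.NumberTheory.GaloisRepresentations.ToLocalRestrictField
import Literature.NumberTheory.GaloisRepresentations.FramedRepTwist
import Literature.RepresentationTheory.Semisimple.IrreducibleOfCharpoly
import Mathlib.RingTheory.Polynomial.ScaleRoots
import HarnessLib

/-!
# Stub A′ `stub_cmTateTwistNewform` of the crux `DyadicOddResidue.DyadicEisensteinFM` — glue, part 1:
# Brauer–Nesbitt transport along Clifford's character, and the Tate twist of an induced Frobenius polynomial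

`--supports` helper of stmt-Langlands-18741 (line `ordinary-seed-propagation`, stub A′).  Everything
here is PROVED (no named fact):

* `exists_conj_of_charpoly_eq_of_isIrreducible` — for framed representations `ρ, ρ'` of a topological
  group over a topological field of characteristic `0` with `det(X - ρ) = det(X - ρ')` and `ρ`
  irreducible, `ρ' = P ρ P⁻¹` for some `P` (irreducibility is detected by characteristic polynomials,
  `isIrreducible_of_charpoly_eq`; Brauer–Nesbitt in characteristic `0`, `exists_conj_of_trace_eq`);
  hence unramifiedness, de Rham-ness at the pinned datum and the labelled Hodge–Tate weights of `ρ`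
  are those of `ρ'` (`isUnramifiedAt_iff_of_forall_eq_conj`, `isDeRhamFramed_toLocal_iff_of_forall_eq_conj`,
  `labelledHodgeTateWeightsAt_eq_of_forall_eq_conj`).
* `scaleRoots` bookkeeping: `charpoly (ρ ⊗ χ)(g) = (charpoly ρ(g)).scaleRoots χ(g)` in rank `2`
  (`charpoly_twist_eq_scaleRoots`), `(X^f - c).scaleRoots s = X^f - s^f c`
  (`X_pow_sub_C_scaleRoots`), and the **Tate twist of an induced Frobenius polynomial**
  (`scaleRoots_inducedFrobPolynomial`, `map_inducedFrobPolynomial`).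
-/

set_option linter.dupNamespace false -- project-wide option; `Summit.Langlands.Langlands` is the mandated namespace

noncomputable section

open scoped MatrixGroups Matrix Classical Polynomial NumberField
open NumberField IsDedekindDomain Filter Field Polynomial
open Literature.NumberTheory.GaloisRepresentations Literature.NumberTheory.PAdicHodge

namespace Summit.Langlands.Langlands.Theorems.DyadicEisensteinFM

/-! ### 1. Brauer–Nesbitt transport -/

section BrauerNesbitt

variable {G : Type*} [Group G] [TopologicalSpace G] {k : Type*} [Field k] [TopologicalSpace k]
  [IsTopologicalRing k] [CharZero k] {n : ℕ}

/-- **Equal characteristic polynomials and one side irreducible ⟹ conjugate.**  If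
`det(X - ρ(g)) = det(X - ρ'(g))` for all `g` and `ρ` is irreducible, then `ρ'` is irreducible too
(`isIrreducible_of_charpoly_eq`), both are semisimple, their traces agree, and Brauer–Nesbitt in
characteristic `0` (`exists_conj_of_trace_eq`) gives `ρ' = P ρ P⁻¹`.
[cite: BourbakiAlgebreVIII2012, VIII § 20 n° 6, Thm. 2, Cor. 1 (p. 378)] -/
theorem exists_conj_of_charpoly_eq_of_isIrreducible (ρ ρ' : FramedRep G k n)
    (hirr : ρ.IsIrreducible) (h : ∀ g, FramedRep.charpoly ρ g = FramedRep.charpoly ρ' g) :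
    ∃ P : GL (Fin n) k, ∀ g, ρ' g = P * ρ g * P⁻¹ := by
  have hirr' : ρ'.IsIrreducible :=
    Literature.RepresentationTheory.Semisimple.isIrreducible_of_charpoly_eq ρ'.toMonoidHom
      ρ.toMonoidHom (fun g => (h g).symm) hirr
  haveI : IsSimpleOrder (Subrepresentation ρ.toRepresentation) := hirr
  haveI : IsSimpleOrder (Subrepresentation ρ'.toRepresentation) := hirr'
  have hss : ρ.toRepresentation.IsSemisimpleRepresentation := inferInstance
  have hss' : ρ'.toRepresentation.IsSemisimpleRepresentation := inferInstance
  refine SorensenPatching.exists_conj_of_trace_eq ρ ρ' hss hss' fun g => ?_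
  rcases Nat.eq_zero_or_pos n with hn | hn
  · subst hn
    simp [Matrix.trace]
  · haveI : Nonempty (Fin n) := ⟨⟨0, hn⟩⟩
    change ((ρ g : GL (Fin n) k) : Matrix (Fin n) (Fin n) k).trace =
      ((ρ' g : GL (Fin n) k) : Matrix (Fin n) (Fin n) k).trace
    rw [Matrix.trace_eq_neg_charpoly_coeff, Matrix.trace_eq_neg_charpoly_coeff]
    have := h g
    unfold FramedRep.charpoly at this
    rw [this]

omit [CharZero k] in
/-- Pointwise conjugacy is `FramedRep.conj`. [folklore] -/
theorem eq_conj_of_forall_eq_conj {ρ ρ' : FramedRep G k n} {P : GL (Fin n) k}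
    (h : ∀ g, ρ' g = P * ρ g * P⁻¹) : ρ' = FramedRep.conj P ρ :=
  ContinuousMonoidHom.ext fun g => by rw [h g, FramedRep.conj_apply]

end BrauerNesbitt

section Transport

variable {K : Type} [Field K] [NumberField K] {ℓ : ℕ} [Fact ℓ.Prime] {n : ℕ}

omit [NumberField K] in
/-- Unramifiedness transports along pointwise conjugacy. [folklore] -/
theorem isUnramifiedAt_iff_of_forall_eq_conj {ρ ρ' : FramedGaloisRep K (PadicAlgCl ℓ) n}
    {P : GL (Fin n) (PadicAlgCl ℓ)} (h : ∀ g, ρ' g = P * ρ g * P⁻¹) (v : HeightOneSpectrum (𝓞 K)) :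
    ρ'.IsUnramifiedAt v ↔ ρ.IsUnramifiedAt v := by
  rw [eq_conj_of_forall_eq_conj h]
  exact FramedGaloisRep.isUnramifiedAt_conj_iff v P ρ

/-- De Rham-ness at a place (any datum) transports along pointwise conjugacy. [folklore] -/
theorem isDeRhamFramed_toLocal_iff_of_forall_eq_conj {ρ ρ' : FramedGaloisRep K (PadicAlgCl ℓ) n}
    {P : GL (Fin n) (PadicAlgCl ℓ)} (h : ∀ g, ρ' g = P * ρ g * P⁻¹) (v : HeightOneSpectrum (𝓞 K))
    (𝔇 : PstWeilDeligneData (v.adicCompletion K) ℓ) :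
    𝔇.IsDeRhamFramed (ρ'.toLocal v) ↔ 𝔇.IsDeRhamFramed (ρ.toLocal v) := by
  rw [eq_conj_of_forall_eq_conj h]
  change 𝔇.IsDeRhamFramed ((FramedRep.conj P ρ).comp _) ↔ _
  rw [FramedRep.conj_comp]
  exact 𝔇.isDeRhamFramed_conj_iff P _

/-- Labelled Hodge–Tate weights at a place (any datum) transport along pointwise conjugacy.
[folklore] -/
theorem labelledHodgeTateWeightsAt_eq_of_forall_eq_conj {ρ ρ' : FramedGaloisRep K (PadicAlgCl ℓ) n}
    {P : GL (Fin n) (PadicAlgCl ℓ)} (h : ∀ g, ρ' g = P * ρ g * P⁻¹) (v : HeightOneSpectrum (𝓞 K))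
    (𝔇 : PstWeilDeligneData (v.adicCompletion K) ℓ) (τ : v.adicCompletion K →+* PadicAlgCl ℓ) :
    ρ'.labelledHodgeTateWeightsAt v 𝔇.algebra 𝔇.𝔅 τ = ρ.labelledHodgeTateWeightsAt v 𝔇.algebra 𝔇.𝔅 τ := by
  rw [eq_conj_of_forall_eq_conj h, FramedGaloisRep.labelledHodgeTateWeightsAt_def,
    FramedGaloisRep.labelledHodgeTateWeightsAt_def]
  change (letI := 𝔇.algebra; 𝔇.𝔅.labelledHodgeTateWeights
      (FramedRep.toContinuousRep ((FramedRep.conj P ρ).comp _)) τ) = _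
  rw [FramedRep.conj_comp]
  exact 𝔇.labelledHodgeTateWeights_conj_eq P _ τ

end Transport

/-! ### 2. `scaleRoots` bookkeeping: Tate twists of Frobenius polynomials -/

section ScaleRoots

variable {A : Type*} [CommRing A]

/-- `(X² - a X + d).scaleRoots s = X² - s a X + s² d`. [folklore] -/
theorem scaleRoots_quadratic [Nontrivial A] (a d s : A) :
    (X ^ 2 - C a * X + C d).scaleRoots s = X ^ 2 - C (s * a) * X + C (s ^ 2 * d) := by
  have hdeg : (X ^ 2 - C a * X + C d).natDegree = 2 := by
    rw [show (X ^ 2 - C a * X + C d : A[X]) = C 1 * X ^ 2 + C (-a) * X + C d by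
      rw [map_one, one_mul, map_neg, neg_mul, sub_eq_add_neg]]
    exact natDegree_quadratic one_ne_zero
  ext i
  rw [coeff_scaleRoots, hdeg]
  simp only [coeff_add, coeff_sub, coeff_X_pow, coeff_C_mul, coeff_X, coeff_C]
  match i with
  | 0 => simp; ring
  | 1 => simp; ring
  | 2 => simp
  | (i + 3) =>
    have h0 : i + 3 ≠ 0 := by simp
    have h1 : i + 3 ≠ 1 := by simp
    have h2 : i + 3 ≠ 2 := by simp
    simp [h2]

/-- `(X^f - c).scaleRoots s = X^f - s^f c`. [folklore] -/
theorem X_pow_sub_C_scaleRoots [Nontrivial A] (f : ℕ) (c s : A) :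
    (X ^ f - C c).scaleRoots s = X ^ f - C (s ^ f * c) := by
  rcases Nat.eq_zero_or_pos f with hf | hf
  · subst hf
    rw [pow_zero, pow_zero, one_mul, ← C_1, ← C_sub, scaleRoots_C]
  ext i
  rw [coeff_scaleRoots, natDegree_X_pow_sub_C]
  simp only [coeff_sub, coeff_X_pow, coeff_C]
  by_cases hi : i = f
  · subst hi
    simp [Nat.pos_iff_ne_zero.mp hf]
  · by_cases hi0 : i = 0
    · subst hi0
      simp [hi]; ring
    · simp [hi, hi0]

variable {G : Type*} [Group G] [TopologicalSpace G] [TopologicalSpace A] [IsTopologicalRing A]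

/-- **Characteristic polynomial of a twist as `scaleRoots`** (rank `2`):
`det(X - (ρ ⊗ χ)(g)) = (det(X - ρ(g))).scaleRoots χ(g)` (`(ρ ⊗ χ)(g) = χ(g) • ρ(g)`, and the
characteristic polynomial of a `2 × 2` matrix is `X² - tr X + det`). [folklore] -/
theorem charpoly_twist_eq_scaleRoots [Nontrivial A] (ρ : FramedRep G A 2) (χ : G →ₜ* Aˣ) (g : G) :
    FramedRep.charpoly (ρ.twist χ) g = (FramedRep.charpoly ρ g).scaleRoots (χ g : A) := by
  unfold FramedRep.charpoly
  rw [FramedRep.coe_twist_apply, Matrix.charpoly_fin_two, Matrix.charpoly_fin_two, Matrix.trace_smul,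
    Matrix.det_smul, Fintype.card_fin, scaleRoots_quadratic, smul_eq_mul]

end ScaleRoots

section Induced

variable {F : Type} [Field F] [NumberField F] {A : Type*} [Field A]

/-- `scaleRoots` is multiplicative over finite products (over a domain). [folklore] -/
theorem finset_prod_scaleRoots {ι : Type*} (s : Finset ι) (P : ι → A[X]) (c : A) :
    (∏ i ∈ s, P i).scaleRoots c = ∏ i ∈ s, (P i).scaleRoots c := by
  induction s using Finset.induction_on with
  | empty => simp
  | insert i s hi ih =>
    rw [Finset.prod_insert hi, Finset.prod_insert hi, mul_scaleRoots_of_noZeroDivisors, ih]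

/-- **Tate twist of an induced Frobenius polynomial**: scaling the roots of
`∏_{w ∣ v} (X^{f(w|v)} - β_w)` by `c` gives `∏_{w ∣ v} (X^{f(w|v)} - c^{f(w|v)} β_w)`. [folklore] -/
theorem scaleRoots_inducedFrobPolynomial (v : HeightOneSpectrum (𝓞 ℚ))
    (β : HeightOneSpectrum (𝓞 F) → A) (c : A) :
    (inducedFrobPolynomial v fun w => X - C (β w)).scaleRoots c =
      inducedFrobPolynomial v fun w => X - C (c ^ w.asIdeal.inertiaDeg (𝓞 ℚ) * β w) := by
  classical
  haveI : Fintype {w : HeightOneSpectrum (𝓞 F) // w.under (𝓞 ℚ) = v} :=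
    @Fintype.ofFinite _ (finite_heightOneSpectrum_under_eq v)
  rw [inducedFrobPolynomial_eq_prod, inducedFrobPolynomial_eq_prod, finset_prod_scaleRoots]
  refine Finset.prod_congr rfl fun w _ => ?_
  simp only [sub_comp, X_comp, C_comp]
  exact X_pow_sub_C_scaleRoots _ _ _

/-- Induced Frobenius polynomials commute with ring maps of the coefficients. [folklore] -/
theorem map_inducedFrobPolynomial {B : Type*} [CommRing B] (f : ℂ →+* B)
    (v : HeightOneSpectrum (𝓞 ℚ)) (β : HeightOneSpectrum (𝓞 F) → ℂ) :
    (inducedFrobPolynomial v fun w => (X - C (β w) : ℂ[X])).map f =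
      inducedFrobPolynomial v fun w => (X - C (f (β w)) : B[X]) := by
  classical
  haveI : Fintype {w : HeightOneSpectrum (𝓞 F) // w.under (𝓞 ℚ) = v} :=
    @Fintype.ofFinite _ (finite_heightOneSpectrum_under_eq v)
  rw [inducedFrobPolynomial_eq_prod, inducedFrobPolynomial_eq_prod, Polynomial.map_prod]
  refine Finset.prod_congr rfl fun w _ => ?_
  simp only [sub_comp, X_comp, C_comp, Polynomial.map_sub, Polynomial.map_pow, map_X, map_C]

/-- **Tate twist of an induced Frobenius polynomial over `ℚ`** (closed form of
`scaleRoots_inducedFrobPolynomial`, the registered sub-goal of this `--supports` helper): for a number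
field `F`, a field `A`, a place `v` of `ℚ`, values `β_w ∈ A` at the places of `F` and `c ∈ A`,
`(∏_{w ∣ v} (X^{f(w|v)} - β_w)).scaleRoots c = ∏_{w ∣ v} (X^{f(w|v)} - c^{f(w|v)} β_w)`. [folklore] -/
theorem tateTwist_inducedFrobPolynomial : ∀ (F : Type) [Field F] [NumberField F] (A : Type) [Field A] (v : IsDedekindDomain.HeightOneSpectrum (NumberField.RingOfIntegers ℚ)) (β : IsDedekindDomain.HeightOneSpectrum (NumberField.RingOfIntegers F) → A) (c : A), Polynomial.scaleRoots (Literature.NumberTheory.GaloisRepresentations.inducedFrobPolynomial v (fun w => Polynomial.X - Polynomial.C (β w))) c = Literature.NumberTheory.GaloisRepresentations.inducedFrobPolynomial v (fun w => Polynomial.X - Polynomial.C (c ^ Ideal.inertiaDeg (IsDedekindDomain.HeightOneSpectrum.asIdeal w) (NumberField.RingOfIntegers ℚ) * β w)) :=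
  fun _ _ _ _ _ v β c => scaleRoots_inducedFrobPolynomial v β c

end Induced

end Summit.Langlands.Langlands.Theorems.DyadicEisensteinFM

end
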